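import Mathlib.LinearAlgebra.Matrix.ToLin
import Mathlib.LinearAlgebra.FiniteDimensional.Basic
import Mathlib.Algebra.BigOperators.Ring.Finset
import Literature.Topology.FourManifolds.KhComplex
import Literature.Topology.FourManifolds.KhComplexQDegreeProofs
import Literature.Topology.FourManifolds.LeeRasmussenLabProofs
import Literature.Topology.FourManifolds.LeeRasmussenProofs
import HarnessLib

/-!
# Lee's change of basis `𝐚 = X + 1`, `𝐛 = X - 1` on the cochain groups

Sibling file of `LeeRasmussen.lean` on the way to Lee's theorem `finrank_leeHomologyZero_eq_two`
(Lee (2005), Thm. 4.2). The cochain group `C^k = (degStates k → ℚ)` of the Khovanov/Lee complex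
of a Gauss diagram has the basis of enhanced states `(σ, λ)` (`λ` a labelling of the circles of
`σ` by `𝟙 ↔ false`, `X ↔ true`). Lee's basis consists of the monomials in `𝐚 = X + 𝟙`,
`𝐛 = X - 𝟙` on the circles; indexing them again by enhanced states `(σ, ℓ)` (`𝐚 ↔ false`,
`𝐛 ↔ true`), the monomial of `(σ, ℓ)` expands in the old basis with coefficient
`(-1)^{#circles labelled (𝟙, 𝐛)}` on `(σ, λ)` (from `𝐚 = 𝟙 + X`, `𝐛 = -𝟙 + X`). This file
defines that **change-of-basis matrix** `leeBasisMat k` and proves it is invertible: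

* `liftLabel`, `labelEquiv` — labellings of a state `σ` (`IsLabelOf`) are the same as functions on
  its set of circles `StateCircle σ`; `stateFibreEquiv` — the enhanced states of degree `k` over a
  fixed state `σ` of that degree are the same as such functions;
* `pairCount σ λ ℓ` — the number of circles of `σ` on which `λ = 𝟙` and `ℓ = 𝐛`, and its
  expression as a product of signs over the circles (`neg_one_pow_pairCount`);
* `leeBasisMat k` (entries `[σ₁ = σ] · (-1)^{pairCount σ λ₁ ℓ}`) and the orthogonality relation
  `leeBasisMat_transpose_mul` : `Mᵀ M = diag (2^{#circles})` (on each circle the `2 × 2` block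
  `[[1, -1], [1, 1]]` has orthogonal columns of square norm `2`);
* `leeBasisMat_mul_transpose` : `M Mᵀ = diag (2^{#circles})` likewise;
* `leeBasis k`, `leeCoord k : (degStates k → ℚ) ≃ₗ[ℚ] (degStates k → ℚ)`, the linear
  automorphisms `Matrix.toLin' (leeBasisMat k)` and `Matrix.toLin' (leeBasisMat k)ᵀ` (the
  latter, "Lee's coordinates", is the one conjugating the Lee differential to a label-preserving
  matrix in the sequel).

Lee (2005), §4 works throughout in the basis `𝐚, 𝐛`; Rasmussen (2010), §2.1 likewise
("it is convenient to work with the basis `{𝐚, 𝐛}`"). No named fact is introduced.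

## References

* E. S. Lee, *An endomorphism of the Khovanov invariant*, Adv. Math. 197 (2005) 554–586, §4
  (the basis `𝐚 = X + 𝟙`, `𝐛 = X - 𝟙`). [cite: Lee2005, §4]
* J. Rasmussen, *Khovanov homology and the slice genus*, Invent. Math. 182 (2010), §2.1.
  [cite: Rasmussen2010, §2.1]
-/

open Function Set Matrix

noncomputable section

namespace Literature.Topology.FourManifolds

namespace GaussDiagram

variable {G : GaussDiagram}

/-! ## Labellings as functions on circles -/

/-- A labelling of the state `σ`, as a function on its circles. [folklore] -/
def liftLabel (σ : G.State) (ℓ : G.Arc → Bool) (h : G.IsLabelOf σ ℓ) : G.StateCircle σ → Bool :=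
  SimpleGraph.ConnectedComponent.lift ℓ fun _ _ p _ ↦ h.eq_of_reachable ⟨p⟩

/-- `liftLabel` evaluated on the component of an arc is the label of the arc. [folklore] -/
@[simp] theorem liftLabel_mk (σ : G.State) (ℓ : G.Arc → Bool) (h : G.IsLabelOf σ ℓ)
    (a : G.Arc) : G.liftLabel σ ℓ h ((G.stateGraph σ).connectedComponentMk a) = ℓ a :=
  SimpleGraph.ConnectedComponent.lift_mk

/-- `liftLabel` evaluated on the circle of an arc is the label of the arc. [folklore] -/
@[simp] theorem liftLabel_circleOf (σ : G.State) (ℓ : G.Arc → Bool) (h : G.IsLabelOf σ ℓ)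
    (a : G.Arc) : G.liftLabel σ ℓ h (G.circleOf σ a) = ℓ a :=
  SimpleGraph.ConnectedComponent.lift_mk

/-- The labelling of an enhanced state over `σ` is a labelling of `σ`. [folklore] -/
theorem isLabelOf_of_state_eq {s : G.EnhancedState} {σ : G.State} (h : s.state = σ) :
    G.IsLabelOf σ s.label := by
  rw [← h]
  exact s.isLabelOf

/-- A function on the circles of `σ`, read on arcs, is a labelling of `σ`. [folklore] -/
theorem isLabelOf_comp_circleOf (σ : G.State) (φ : G.StateCircle σ → Bool) :
    G.IsLabelOf σ (φ ∘ G.circleOf σ) := fun _ _ hab ↦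
  congrArg φ (SimpleGraph.ConnectedComponent.sound hab.reachable)

/-- **Labellings of a state are functions on its circles.** [folklore] -/
def labelEquiv (σ : G.State) : {ℓ : G.Arc → Bool // G.IsLabelOf σ ℓ} ≃ (G.StateCircle σ → Bool) where
  toFun ℓ := G.liftLabel σ ℓ.1 ℓ.2
  invFun φ := ⟨φ ∘ G.circleOf σ, isLabelOf_comp_circleOf σ φ⟩
  left_inv ℓ := by
    apply Subtype.ext
    funext a
    simp
  right_inv φ := by
    funext C
    induction C using SimpleGraph.ConnectedComponent.ind with
    | h a => simp; rfl

/-- All enhanced states over one state have the homological degree of that state. [folklore] -/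
theorem homDegree_eq_of_state_eq {s : G.EnhancedState} {σ : G.State} (h : s.state = σ) :
    homDegree s = (σ.weight : ℤ) - G.nMinus := by
  rw [homDegree, h]

/-- **The enhanced states of degree `k` over a fixed state `σ` are the functions on the circles
of `σ`** (when `σ` has degree `k`; otherwise there are none). [folklore] -/
def stateFibreEquiv (k : ℤ) (σ : G.State) (hk : (σ.weight : ℤ) - G.nMinus = k) :
    {s : G.degStates k // s.1.state = σ} ≃ (G.StateCircle σ → Bool) where
  toFun s := G.liftLabel σ s.1.1.label (isLabelOf_of_state_eq s.2)
  invFun φ := ⟨⟨⟨σ, φ ∘ G.circleOf σ, isLabelOf_comp_circleOf σ φ⟩, by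
    rw [homDegree]; exact hk⟩, rfl⟩
  left_inv := by
    rintro ⟨⟨s, hs⟩, hσ⟩
    simp only at hσ
    subst hσ
    apply Subtype.ext; apply Subtype.ext
    refine EnhancedState.ext' rfl ?_
    funext a
    simp
  right_inv φ := by
    funext C
    induction C using SimpleGraph.ConnectedComponent.ind with
    | h a => simp; rfl

/-! ## The sign of a pair of labellings -/

/-- The number of circles of `σ` on which `λ = 𝟙` (`false`) and `ℓ = 𝐛` (`true`): the exponent
of the sign of the old basis vector `(σ, λ)` in Lee's monomial `(σ, ℓ)` (`𝐛 = -𝟙 + X`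
contributes `-1` exactly on such circles). Lee (2005), §4. [cite: Lee2005, §4] -/
def pairCount (σ : G.State) (lam ell : G.Arc → Bool) : ℕ :=
  (Finset.univ.filter fun C : G.StateCircle σ ↦
    ∃ a, G.circleOf σ a = C ∧ (!lam a && ell a) = true).card

/-- The defining predicate of `pairCount`, for labellings, on the circle of an arc. [folklore] -/
theorem exists_circleOf_iff {σ : G.State} {lam ell : G.Arc → Bool} (hl : G.IsLabelOf σ lam)
    (he : G.IsLabelOf σ ell) (C : G.StateCircle σ) :
    (∃ a, G.circleOf σ a = C ∧ (!lam a && ell a) = true) ↔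
      (!G.liftLabel σ lam hl C && G.liftLabel σ ell he C) = true := by
  induction C using SimpleGraph.ConnectedComponent.ind with
  | h b =>
    change (∃ a, G.circleOf σ a = G.circleOf σ b ∧ _) ↔ _
    rw [liftLabel_mk, liftLabel_mk]
    constructor
    · rintro ⟨a, ha, h⟩
      rw [hl.eq_of_reachable (circleOf_eq_iff.1 ha.symm), he.eq_of_reachable (circleOf_eq_iff.1 ha.symm)]
      exact h
    · exact fun h ↦ ⟨b, rfl, h⟩

/-- **The sign as a product over circles**: `(-1)^{pairCount σ λ ℓ} = ∏_C s(λ_C, ℓ_C)` with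
`s(𝟙, 𝐛) = -1` and `s = 1` otherwise. [folklore] -/
theorem neg_one_pow_pairCount {σ : G.State} {lam ell : G.Arc → Bool} (hl : G.IsLabelOf σ lam)
    (he : G.IsLabelOf σ ell) :
    ((-1 : ℚ)) ^ G.pairCount σ lam ell =
      ∏ C : G.StateCircle σ,
        (if (!G.liftLabel σ lam hl C && G.liftLabel σ ell he C) = true then (-1 : ℚ) else 1) := by
  classical
  rw [pairCount, Finset.prod_ite, Finset.prod_const_one, mul_one, Finset.prod_const]
  congr 2
  exact Finset.filter_congr fun C _ ↦ exists_circleOf_iff hl he C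

/-! ## The change-of-basis matrix -/

variable (G) in
/-- **Lee's change-of-basis matrix** on the degree-`k` cochain group: the entry at
(`(σ₁, λ)`, `(σ, ℓ)`) is `0` unless `σ₁ = σ`, and then `(-1)^{pairCount σ λ ℓ}` — the
coefficient of the old basis vector `(σ, λ)` (labels `𝟙`, `X`) in Lee's monomial `(σ, ℓ)`
(labels `𝐚 = 𝟙 + X`, `𝐛 = -𝟙 + X`). On each circle this is the block `[[1, -1], [1, 1]]`.
Lee (2005), §4; Rasmussen (2010), §2.1. [cite: Lee2005, §4] -/
def leeBasisMat (k : ℤ) : Matrix (G.degStates k) (G.degStates k) ℚ :=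
  Matrix.of fun s₁ s ↦
    if s₁.1.state = s.1.state then (-1 : ℚ) ^ G.pairCount s.1.state s₁.1.label s.1.label else 0

/-- The sign attached on one circle to a pair of labels (`-1` for `(𝟙, 𝐛)`, else `1`).
[folklore] -/
def pairSign (x t : Bool) : ℚ := if (!x && t) = true then -1 else 1

/-- On one circle the columns of `[[1, -1], [1, 1]]` are orthogonal of square norm `2`:
`∑ₓ s(x, t) s(x, t') = 2 [t = t']`. [folklore] -/
theorem sum_pairSign_mul_pairSign (t t' : Bool) :
    ∑ x : Bool, pairSign x t * pairSign x t' = if t = t' then 2 else 0 := by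
  cases t <;> cases t' <;> norm_num [pairSign]

/-- On one circle the rows of `[[1, -1], [1, 1]]` are orthogonal of square norm `2`:
`∑ₜ s(x, t) s(x', t) = 2 [x = x']`. [folklore] -/
theorem sum_pairSign_mul_pairSign' (x x' : Bool) :
    ∑ t : Bool, pairSign x t * pairSign x' t = if x = x' then 2 else 0 := by
  cases x <;> cases x' <;> norm_num [pairSign]

/-- **Orthogonality of Lee's basis change**: `(Mᵀ M)((σ₂, ℓ₂), (σ, ℓ)) = [s₂ = s] · 2^{#circles(σ)}`.
On the block of the state `σ` the matrix is the Kronecker product over the circles of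
`[[1, -1], [1, 1]]`, whose Gram matrix is `2 · 1`. [cite: Lee2005, §4] -/
theorem leeBasisMat_transpose_mul_apply (k : ℤ) (s₂ s : G.degStates k) :
    ((G.leeBasisMat k)ᵀ * G.leeBasisMat k) s₂ s =
      if s₂ = s then (2 : ℚ) ^ G.circleCount s.1.state else 0 := by
  classical
  rw [Matrix.mul_apply]
  simp only [Matrix.transpose_apply, leeBasisMat, Matrix.of_apply]
  by_cases hσ : s₂.1.state = s.1.state
  swap
  · -- different states: every term vanishes, and `s₂ ≠ s`
    rw [if_neg (fun h ↦ hσ (by rw [h]))]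
    refine Finset.sum_eq_zero fun s₁ _ ↦ ?_
    by_cases h1 : s₁.1.state = s₂.1.state
    · rw [if_neg (fun h2 ↦ hσ (h1.symm.trans h2)), mul_zero]
    · rw [if_neg h1, zero_mul]
  -- same state `σ`: re-index the sum over the fibre of `σ` by functions on circles
  set σ := s.1.state with hσdef
  have hk : (σ.weight : ℤ) - G.nMinus = k := by rw [hσdef, ← homDegree]; exact s.2
  have hsum : ∑ s₁ : G.degStates k,
      (if s₁.1.state = s₂.1.state then (-1 : ℚ) ^ G.pairCount s₂.1.state s₁.1.label s₂.1.label
        else 0) *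
      (if s₁.1.state = s.1.state then (-1 : ℚ) ^ G.pairCount s.1.state s₁.1.label s.1.label
        else 0) =
      ∑ s₁ : {s₁ : G.degStates k // s₁.1.state = σ},
        (-1 : ℚ) ^ G.pairCount σ s₁.1.1.label s₂.1.label *
          (-1 : ℚ) ^ G.pairCount σ s₁.1.1.label s.1.label := by
    rw [← Finset.sum_subset (Finset.filter_subset (fun s₁ : G.degStates k ↦ s₁.1.state = σ)
      Finset.univ)]
    · rw [Finset.sum_subtype (Finset.univ.filter fun s₁ : G.degStates k ↦ s₁.1.state = σ)
        (p := fun s₁ : G.degStates k ↦ s₁.1.state = σ) (fun s₁ ↦ by simp)]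
      refine Fintype.sum_congr _ _ fun s₁ ↦ ?_
      rw [if_pos (s₁.2.trans hσ.symm), if_pos s₁.2, hσ]
    · intro s₁ _ hs₁
      rw [Finset.mem_filter, not_and] at hs₁
      rw [if_neg (hs₁ (Finset.mem_univ _)), mul_zero]
  rw [hsum]
  -- labels as functions on circles
  have hℓ₂ : G.IsLabelOf σ s₂.1.label := hσ ▸ s₂.1.isLabelOf
  have hℓ : G.IsLabelOf σ s.1.label := s.1.isLabelOf
  rw [Fintype.sum_equiv (G.stateFibreEquiv k σ hk) _
    (fun φ ↦ ∏ C : G.StateCircle σ,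
      pairSign (φ C) (G.liftLabel σ _ hℓ₂ C) * pairSign (φ C) (G.liftLabel σ _ hℓ C))]
  swap
  · rintro ⟨⟨s₁, hs₁⟩, hσ₁⟩
    simp only at hσ₁
    have hℓ₁ : G.IsLabelOf σ s₁.label := isLabelOf_of_state_eq hσ₁
    rw [neg_one_pow_pairCount hℓ₁ hℓ₂, neg_one_pow_pairCount hℓ₁ hℓ, ← Finset.prod_mul_distrib]
    refine Finset.prod_congr rfl fun C _ ↦ ?_
    rfl
  rw [← Fintype.prod_sum (fun (C : G.StateCircle σ) (x : Bool) ↦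
    pairSign x (G.liftLabel σ _ hℓ₂ C) * pairSign x (G.liftLabel σ _ hℓ C))]
  · simp only [sum_pairSign_mul_pairSign]
    by_cases heq : s₂ = s
    · subst heq
      rw [if_pos rfl]
      simp [circleCount, Finset.card_univ]
    · rw [if_neg heq]
      -- some circle carries different labels
      have : ∃ C, G.liftLabel σ _ hℓ₂ C ≠ G.liftLabel σ _ hℓ C := by
        by_contra hall
        push Not at hall
        apply heq
        apply Subtype.ext
        refine EnhancedState.ext' hσ ?_
        funext a
        have := hall (G.circleOf σ a)
        simpa using this
      obtain ⟨C, hC⟩ := this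
      exact Finset.prod_eq_zero (Finset.mem_univ C) (if_neg hC)

/-- Matrix form of the orthogonality relation: `Mᵀ M` is the invertible diagonal matrix
`diag (2^{#circles})`. [cite: Lee2005, §4] -/
theorem leeBasisMat_transpose_mul (k : ℤ) :
    (G.leeBasisMat k)ᵀ * G.leeBasisMat k =
      Matrix.diagonal fun s : G.degStates k ↦ (2 : ℚ) ^ G.circleCount s.1.state := by
  ext s₂ s
  rw [leeBasisMat_transpose_mul_apply, Matrix.diagonal_apply]
  split_ifs with h
  · subst h; rfl
  · rfl

/-- **Orthogonality, row form**: `(M Mᵀ)((σ₁, λ₁), (σ₃, λ₃)) = [s₁ = s₃] · 2^{#circles(σ₁)}`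
(the rows of the circle block `[[1, -1], [1, 1]]` are orthogonal of square norm `2` as well).
[cite: Lee2005, §4] -/
theorem leeBasisMat_mul_transpose_apply (k : ℤ) (s₁ s₃ : G.degStates k) :
    (G.leeBasisMat k * (G.leeBasisMat k)ᵀ) s₁ s₃ =
      if s₁ = s₃ then (2 : ℚ) ^ G.circleCount s₁.1.state else 0 := by
  classical
  rw [Matrix.mul_apply]
  simp only [Matrix.transpose_apply, leeBasisMat, Matrix.of_apply]
  by_cases hσ : s₃.1.state = s₁.1.state
  swap
  · rw [if_neg (fun h ↦ hσ (by rw [h]))]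
    refine Finset.sum_eq_zero fun s _ ↦ ?_
    by_cases h1 : s₁.1.state = s.1.state
    · have h3 : ¬ s₃.1.state = s.1.state := fun h3 ↦ hσ (h3.trans h1.symm)
      rw [if_pos h1, if_neg h3, mul_zero]
    · rw [if_neg h1, zero_mul]
  set σ := s₁.1.state with hσdef
  have hk : (σ.weight : ℤ) - G.nMinus = k := by rw [hσdef, ← homDegree]; exact s₁.2
  have hsum : ∑ s : G.degStates k,
      (if s₁.1.state = s.1.state then (-1 : ℚ) ^ G.pairCount s.1.state s₁.1.label s.1.label
        else 0) *
      (if s₃.1.state = s.1.state then (-1 : ℚ) ^ G.pairCount s.1.state s₃.1.label s.1.label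
        else 0) =
      ∑ s : {s : G.degStates k // s.1.state = σ},
        (-1 : ℚ) ^ G.pairCount σ s₁.1.label s.1.1.label *
          (-1 : ℚ) ^ G.pairCount σ s₃.1.label s.1.1.label := by
    rw [← Finset.sum_subset (Finset.filter_subset (fun s : G.degStates k ↦ s.1.state = σ)
      Finset.univ)]
    · rw [Finset.sum_subtype (Finset.univ.filter fun s : G.degStates k ↦ s.1.state = σ)
        (p := fun s : G.degStates k ↦ s.1.state = σ) (fun s ↦ by simp)]
      refine Fintype.sum_congr _ _ fun s ↦ ?_
      rw [if_pos s.2.symm, if_pos (hσ.trans s.2.symm), s.2]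
    · intro s _ hs
      rw [Finset.mem_filter, not_and] at hs
      rw [if_neg (fun h ↦ hs (Finset.mem_univ _) h.symm), zero_mul]
  rw [hsum]
  have hℓ₁ : G.IsLabelOf σ s₁.1.label := s₁.1.isLabelOf
  have hℓ₃ : G.IsLabelOf σ s₃.1.label := isLabelOf_of_state_eq hσ
  rw [Fintype.sum_equiv (G.stateFibreEquiv k σ hk) _
    (fun φ ↦ ∏ C : G.StateCircle σ,
      pairSign (G.liftLabel σ _ hℓ₁ C) (φ C) * pairSign (G.liftLabel σ _ hℓ₃ C) (φ C))]
  swap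
  · rintro ⟨⟨s, hs⟩, hσs⟩
    simp only at hσs
    have hℓ : G.IsLabelOf σ s.label := isLabelOf_of_state_eq hσs
    rw [neg_one_pow_pairCount hℓ₁ hℓ, neg_one_pow_pairCount hℓ₃ hℓ, ← Finset.prod_mul_distrib]
    refine Finset.prod_congr rfl fun C _ ↦ ?_
    rfl
  rw [← Fintype.prod_sum (fun (C : G.StateCircle σ) (x : Bool) ↦
    pairSign (G.liftLabel σ _ hℓ₁ C) x * pairSign (G.liftLabel σ _ hℓ₃ C) x)]
  simp only [sum_pairSign_mul_pairSign']
  by_cases heq : s₁ = s₃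
  · subst heq
    rw [if_pos rfl]
    simp [circleCount, Finset.card_univ]
  · rw [if_neg heq]
    have : ∃ C, G.liftLabel σ _ hℓ₁ C ≠ G.liftLabel σ _ hℓ₃ C := by
      by_contra hall
      push Not at hall
      apply heq
      apply Subtype.ext
      refine EnhancedState.ext' hσ.symm ?_
      funext a
      have := hall (G.circleOf σ a)
      simpa using this
    obtain ⟨C, hC⟩ := this
    exact Finset.prod_eq_zero (Finset.mem_univ C) (if_neg hC)

/-- Matrix form: `M Mᵀ` is the invertible diagonal matrix `diag (2^{#circles})`. [cite: Lee2005, §4] -/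
theorem leeBasisMat_mul_transpose (k : ℤ) :
    G.leeBasisMat k * (G.leeBasisMat k)ᵀ =
      Matrix.diagonal fun s : G.degStates k ↦ (2 : ℚ) ^ G.circleCount s.1.state := by
  ext s₁ s₃
  rw [leeBasisMat_mul_transpose_apply, Matrix.diagonal_apply]

/-- Lee's change of basis is injective (`Mᵀ M` is an invertible diagonal matrix). [folklore] -/
theorem leeBasisMat_toLin'_injective (k : ℤ) :
    Function.Injective (Matrix.toLin' (G.leeBasisMat k)) := by
  intro x y hxy
  have h := congrArg (Matrix.toLin' (G.leeBasisMat k)ᵀ) hxy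
  rw [← Matrix.toLin'_mul_apply, ← Matrix.toLin'_mul_apply, leeBasisMat_transpose_mul] at h
  funext s
  have hs := congrFun h s
  simp only [Matrix.toLin'_apply, Matrix.mulVec_diagonal] at hs
  exact mul_left_cancel₀ (pow_ne_zero _ two_ne_zero) hs

variable (G) in
/-- **Lee's change of basis** on the degree-`k` cochain group of the Khovanov/Lee complex of
`G`: the linear automorphism of `degStates k → ℚ` sending the coordinate vector of the monomial
`(σ, ℓ)` in `𝐚 = X + 𝟙`, `𝐛 = X - 𝟙` to its expansion in the enhanced states `(σ, λ)`
(matrix `leeBasisMat k`; bijective by `leeBasisMat_toLin'_injective` and finite dimension).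
Lee (2005), §4; Rasmussen (2010), §2.1. [cite: Lee2005, §4] -/
def leeBasis (k : ℤ) : (G.degStates k → ℚ) ≃ₗ[ℚ] (G.degStates k → ℚ) :=
  LinearEquiv.ofBijective (Matrix.toLin' (G.leeBasisMat k))
    ⟨leeBasisMat_toLin'_injective k,
      LinearMap.surjective_of_injective (leeBasisMat_toLin'_injective k)⟩

/-- `leeBasis` is `Matrix.toLin'` of `leeBasisMat`. [folklore] -/
@[simp] theorem leeBasis_apply (k : ℤ) (x : G.degStates k → ℚ) :
    G.leeBasis k x = Matrix.toLin' (G.leeBasisMat k) x := rfl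

/-- The transpose of Lee's change of basis is injective (`M Mᵀ` is an invertible diagonal
matrix). [folklore] -/
theorem leeBasisMat_transpose_toLin'_injective (k : ℤ) :
    Function.Injective (Matrix.toLin' (G.leeBasisMat k)ᵀ) := by
  intro x y hxy
  have h := congrArg (Matrix.toLin' (G.leeBasisMat k)) hxy
  rw [← Matrix.toLin'_mul_apply, ← Matrix.toLin'_mul_apply, leeBasisMat_mul_transpose] at h
  funext s
  have hs := congrFun h s
  simp only [Matrix.toLin'_apply, Matrix.mulVec_diagonal] at hs
  exact mul_left_cancel₀ (pow_ne_zero _ two_ne_zero) hs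

variable (G) in
/-- **Lee's coordinates**: the linear automorphism of the degree-`k` cochain group given by the
transpose `Mᵀ` of Lee's change-of-basis matrix — it sends a cochain to its pairings with Lee's
monomials `(σ, ℓ)` (up to the factor `2^{#circles}` these are the coordinates in the basis `𝐚`,
`𝐛`, by `leeBasisMat_transpose_mul`; this is Lee's inner product making the monomials in `𝐚`,
`𝐛` orthogonal, Lee (2005), §4.4.2). The Lee differential becomes label-preserving in these
coordinates. [cite: Lee2005, §4.4] -/
def leeCoord (k : ℤ) : (G.degStates k → ℚ) ≃ₗ[ℚ] (G.degStates k → ℚ) :=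
  LinearEquiv.ofBijective (Matrix.toLin' (G.leeBasisMat k)ᵀ)
    ⟨leeBasisMat_transpose_toLin'_injective k,
      LinearMap.surjective_of_injective (leeBasisMat_transpose_toLin'_injective k)⟩

/-- `leeCoord` is `Matrix.toLin'` of `leeBasisMatᵀ`. [folklore] -/
@[simp] theorem leeCoord_apply (k : ℤ) (x : G.degStates k → ℚ) :
    G.leeCoord k x = Matrix.toLin' (G.leeBasisMat k)ᵀ x := rfl

end GaussDiagram

end Literature.Topology.FourManifolds
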